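import Mathlib
import Summits.NavierStokesRegularity.NavierStokesRegularity.Theorems.FilamentSkeletonRssKelvinGateFreeBounds

/-!
# Route `FilamentSkeletonRss` · crux `TransverseReduction1A` (stmt-27414; successor of the aside `TransverseReductionRJ`,
# stmt-21221) — line `kelvin_gate`: SCALE INEQUALITIES AT A REAL EXPONENT and the TRANSPORT KERNEL at exponent `a > 1`

Helper file (theorems only, `--as helper`).  HONEST FRAMING: analysis bookkeeping for a HYPOTHETICAL filament-type rotating
self-similar blow-up route; nothing here bears on Navier–Stokes regularity; no stub is proved here.

The Ornstein–Uhlenbeck resolvent `W = ∫₀^∞ W_s ds`, `W_s(y) = (e^{-s/2}R_{−αs})(e^{τ_sΔ}G)(e^{-s/2}R_{αs}y)` (`τ_s = 1 − e^{-s}`), of a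
datum `G` with the weight `(1+|x|)^a`, `1 < a < 2` (the projected data of the sharp-scale free Kelvin gate, design memo
SHARP-WEIGHTS-DESIGN-21221-g7), is estimated slice by slice; this file supplies the one-variable inequalities in `s`:

* `one_add_le_exp_mul_weight`, `rpow_weight_le_exp_mul` — `(1+r)^w ≤ e^{ws/2} (1 + e^{-s/2} r)^w` (`w, s, r ≥ 0`): the target weight
  is traded for the data weight at the cost `e^{ws/2}`;
* `heatTime_rpow_neg_le_one_add` — `(1 − e^{-s})^{-p} ≤ 1 + s^{-p}` (`0 ≤ p ≤ 1`, `s > 0`);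
* `integrableOn_exp_neg_mul_one_add_rpow_neg` — `e^{-bs}(1 + s^{-p})` is integrable on `(0, ∞)` (`b > 0`, `p < 1`);
* `transport_kernel_rpow` — **the transport kernel at exponent `a > 1`**:
  `∫₀^∞ e^{-s/2} (1 + e^{-s/2} r)^{-a} ds ≤ (2a/(a−1)) / (1 + r)` for `r ≥ 0` (exact value `2(1 − (1+r)^{1−a})/((a−1)r)`; the
  critical output weight `⟨y⟩^{-1}` of the value `W(y)` needs data weight `a > 1`, and this is the only place where it is used).
-/

set_option linter.dupNamespace false

noncomputable section

namespace Summit.NavierStokesRegularity.NavierStokesRegularity.Theorems.KelvinGate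

open Set Filter Topology MeasureTheory Real

/-! ## Trading the target weight for the data weight -/

/-- `1 + r ≤ e^{s/2} (1 + e^{-s/2} r)` for `s ≥ 0`, `r ≥ 0`. -/
theorem one_add_le_exp_mul_weight {s r : ℝ} (hs : 0 ≤ s) (hr : 0 ≤ r) :
    1 + r ≤ exp (s / 2) * (1 + exp (-(s / 2)) * r) := by
  have h3 : exp (s / 2) * exp (-(s / 2)) = 1 := by rw [← exp_add, add_neg_cancel, exp_zero]
  have h4 : 1 ≤ exp (s / 2) := one_le_exp (by linarith)
  nlinarith [exp_pos (-(s / 2))]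

/-- `(1 + r)^w ≤ e^{ws/2} (1 + e^{-s/2} r)^w` for `w, s, r ≥ 0`. -/
theorem rpow_weight_le_exp_mul {w s r : ℝ} (hw : 0 ≤ w) (hs : 0 ≤ s) (hr : 0 ≤ r) :
    (1 + r) ^ w ≤ exp (w * s / 2) * (1 + exp (-(s / 2)) * r) ^ w := by
  have hpos : 0 ≤ 1 + exp (-(s / 2)) * r := by positivity
  calc (1 + r) ^ w ≤ (exp (s / 2) * (1 + exp (-(s / 2)) * r)) ^ w :=
        rpow_le_rpow (by positivity) (one_add_le_exp_mul_weight hs hr) hw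
    _ = exp (w * s / 2) * (1 + exp (-(s / 2)) * r) ^ w := by
        rw [mul_rpow (exp_pos _).le hpos, ← exp_mul]; congr 2; ring

/-- The inverse form: `(1 + e^{-s/2} r)^{-w} ≤ e^{ws/2} (1 + r)^{-w}` for `w, s, r ≥ 0`. -/
theorem rpow_neg_weight_le_exp_mul {w s r : ℝ} (hw : 0 ≤ w) (hs : 0 ≤ s) (hr : 0 ≤ r) :
    (1 + exp (-(s / 2)) * r) ^ (-w) ≤ exp (w * s / 2) * (1 + r) ^ (-w) := by
  have h1 : 0 < 1 + r := by positivity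
  have h2 : 0 < 1 + exp (-(s / 2)) * r := by positivity
  have h := rpow_weight_le_exp_mul hw hs hr
  rw [rpow_neg h1.le, rpow_neg h2.le, ← div_eq_mul_inv, le_div_iff₀ (rpow_pos_of_pos h1 _), mul_comm]
  calc (1 + r) ^ w * ((1 + exp (-(s / 2)) * r) ^ w)⁻¹
      ≤ (exp (w * s / 2) * (1 + exp (-(s / 2)) * r) ^ w) * ((1 + exp (-(s / 2)) * r) ^ w)⁻¹ :=
        mul_le_mul_of_nonneg_right h (inv_nonneg.2 (rpow_nonneg h2.le _))
    _ = exp (w * s / 2) := by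
        rw [mul_assoc, mul_inv_cancel₀ (rpow_pos_of_pos h2 _).ne', mul_one]

/-! ## The heat-time singularity at a real exponent -/

/-- `s/(1+s) ≤ 1 − e^{-s}` (from `1 + s ≤ e^{s}`). -/
theorem div_one_add_le_heatTime {s : ℝ} (hs : 0 ≤ s) : s / (1 + s) ≤ 1 - exp (-s) := by
  have h := add_one_le_exp s
  have he : 0 < exp (-s) := exp_pos _
  have h2 : (s + 1) * exp (-s) ≤ 1 := by
    have := mul_le_mul_of_nonneg_right h he.le
    rwa [← exp_add, add_neg_cancel, exp_zero] at this
  rw [div_le_iff₀ (by linarith)]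
  nlinarith

/-- `(1 − e^{-s})^{-p} ≤ 1 + s^{-p}` for `s > 0`, `0 ≤ p ≤ 1` (from `1 − e^{-s} ≥ s/(1+s)` and the subadditivity
`(1 + u)^p ≤ 1 + u^p`). -/
theorem heatTime_rpow_neg_le_one_add {s p : ℝ} (hs : 0 < s) (hp0 : 0 ≤ p) (hp1 : p ≤ 1) :
    (1 - exp (-s)) ^ (-p) ≤ 1 + s ^ (-p) := by
  have hpos : 0 < s / (1 + s) := by positivity
  calc (1 - exp (-s)) ^ (-p) ≤ (s / (1 + s)) ^ (-p) :=
        rpow_le_rpow_of_nonpos hpos (div_one_add_le_heatTime hs.le) (by linarith)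
    _ = (1 + s⁻¹) ^ p := by
        rw [rpow_neg hpos.le, ← inv_rpow hpos.le, inv_div, add_div, div_self hs.ne', one_div, add_comm]
    _ ≤ (1 : ℝ) ^ p + s⁻¹ ^ p := rpow_add_le_add_rpow zero_le_one (inv_nonneg.2 hs.le) hp0 hp1
    _ = 1 + s ^ (-p) := by rw [one_rpow, inv_rpow hs.le, ← rpow_neg hs.le]

/-- `e^{-bs} (1 + s^{-p})` is integrable on `(0, ∞)` for `b > 0`, `p < 1`. -/
theorem integrableOn_exp_neg_mul_one_add_rpow_neg {b p : ℝ} (hb : 0 < b) (hp1 : p < 1) :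
    IntegrableOn (fun s : ℝ => exp (-(b * s)) * (1 + s ^ (-p))) (Ioi 0) := by
  have h1 : IntegrableOn (fun s : ℝ => exp (-(b * s))) (Ioi 0) := by
    have : (fun s : ℝ => exp (-(b * s))) = fun s => exp ((-b) * s) := by funext s; congr 1; ring
    rw [this]; exact integrableOn_exp_mul_Ioi (by linarith) 0
  have h2 : IntegrableOn (fun s : ℝ => s ^ (-p) * exp (-(b * s))) (Ioi 0) := by
    have h := integrableOn_rpow_mul_exp_neg_mul_rpow (s := -p) (p := 1) (b := b) (by linarith) le_rfl hb
    refine h.congr_fun (fun _ _ => ?_) measurableSet_Ioi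
    simp only [rpow_one, neg_mul]
  exact (h1.add h2).congr_fun (fun s _ => by simp only [Pi.add_apply]; ring) measurableSet_Ioi

/-! ## The transport kernel at exponent `a > 1` -/

/-- **The transport kernel at exponent `a > 1`**: for `r ≥ 0` the function `s ↦ e^{-s/2}(1 + e^{-s/2} r)^{-a}` is integrable on
`(0, ∞)` and `∫₀^∞ e^{-s/2}(1 + e^{-s/2} r)^{-a} ds ≤ (2a/(a−1))/(1+r)`.  (Small `(a−1)r`: the integrand is at most `e^{-s/2}`, integral
`≤ 2`; large `(a−1)r`: the antiderivative `(2/((a−1)r))(1 + e^{-s/2}r)^{1−a}` gives the exact value `2(1 − (1+r)^{1−a})/((a−1)r) ≤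
2/((a−1)r)`.) -/
theorem transport_kernel_rpow {a r : ℝ} (ha : 1 < a) (hr : 0 ≤ r) :
    IntegrableOn (fun s : ℝ => exp (-(s / 2)) * (1 + exp (-(s / 2)) * r) ^ (-a)) (Ioi 0) ∧
    ∫ s in Ioi (0:ℝ), exp (-(s / 2)) * (1 + exp (-(s / 2)) * r) ^ (-a) ≤ (2 * a / (a - 1)) / (1 + r) := by
  have ha1 : 0 < a - 1 := by linarith
  have hw : ∀ s : ℝ, 0 < 1 + exp (-(s / 2)) * r := fun s => by positivity
  have hle1 : ∀ s : ℝ, (1 + exp (-(s / 2)) * r) ^ (-a) ≤ 1 := fun s =>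
    rpow_le_one_of_one_le_of_nonpos (by nlinarith [exp_pos (-(s / 2))]) (by linarith)
  obtain ⟨hI, hIval⟩ := integral_exp_neg_half_Ioi
  have hcont : Continuous fun s : ℝ => exp (-(s / 2)) * (1 + exp (-(s / 2)) * r) ^ (-a) := by
    refine (continuous_exp.comp (continuous_id.div_const 2).neg).mul ?_
    exact ((continuous_const.add ((continuous_exp.comp (continuous_id.div_const 2).neg).mul continuous_const)).rpow_const
      fun s => Or.inl (hw s).ne')
  have hint : IntegrableOn (fun s : ℝ => exp (-(s / 2)) * (1 + exp (-(s / 2)) * r) ^ (-a)) (Ioi 0) := by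
    refine hI.mono' hcont.aestronglyMeasurable ((ae_restrict_iff' measurableSet_Ioi).2 (Eventually.of_forall fun s _ => ?_))
    rw [Real.norm_of_nonneg (mul_nonneg (exp_pos _).le (rpow_nonneg (hw s).le _))]
    calc exp (-(s / 2)) * (1 + exp (-(s / 2)) * r) ^ (-a) ≤ exp (-(s / 2)) * 1 :=
          mul_le_mul_of_nonneg_left (hle1 s) (exp_pos _).le
      _ = exp (-(s / 2)) := mul_one _
  refine ⟨hint, ?_⟩
  by_cases hsmall : (a - 1) * r ≤ 1
  · -- integrand ≤ `e^{-s/2}`, integral ≤ 2 ≤ (2a/(a-1))/(1+r)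
    have h1 : ∫ s in Ioi (0:ℝ), exp (-(s / 2)) * (1 + exp (-(s / 2)) * r) ^ (-a) ≤ 2 := by
      calc ∫ s in Ioi (0:ℝ), exp (-(s / 2)) * (1 + exp (-(s / 2)) * r) ^ (-a)
          ≤ ∫ s in Ioi (0:ℝ), exp (-(s / 2)) := by
            refine integral_mono hint hI fun s => ?_
            calc exp (-(s / 2)) * (1 + exp (-(s / 2)) * r) ^ (-a) ≤ exp (-(s / 2)) * 1 :=
                  mul_le_mul_of_nonneg_left (hle1 s) (exp_pos _).le
              _ = exp (-(s / 2)) := mul_one _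
        _ = 2 := hIval
    refine h1.trans ?_
    rw [le_div_iff₀ (by positivity), div_eq_mul_inv]
    have : 2 * (1 + r) * (a - 1) ≤ 2 * a := by nlinarith
    calc 2 * (1 + r) = 2 * (1 + r) * (a - 1) * (a - 1)⁻¹ := by field_simp
      _ ≤ 2 * a * (a - 1)⁻¹ := mul_le_mul_of_nonneg_right this (inv_nonneg.2 ha1.le)
  · -- exact value by the fundamental theorem of calculus on `(0, ∞)`
    rw [not_le] at hsmall
    have hr0 : 0 < r := by
      rcases hr.eq_or_lt with h | h
      · rw [← h, mul_zero] at hsmall; linarith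
      · exact h
    set K : ℝ := 2 / ((a - 1) * r) with hK
    have hK0 : 0 < K := by positivity
    -- antiderivative `Φ(s) = K (1 + e^{-s/2} r)^{1-a}`
    have hderiv : ∀ s : ℝ, HasDerivAt (fun t : ℝ => K * (1 + exp (-(t / 2)) * r) ^ (1 - a))
        (exp (-(s / 2)) * (1 + exp (-(s / 2)) * r) ^ (-a)) s := by
      intro s
      have h1 : HasDerivAt (fun t : ℝ => 1 + exp (-(t / 2)) * r) (exp (-(s / 2)) * (-(1/2:ℝ)) * r) s := by
        have he : HasDerivAt (fun t : ℝ => exp (-(t / 2))) (exp (-(s / 2)) * (-(1/2:ℝ))) s := by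
          have h := ((hasDerivAt_id s).div_const 2).fun_neg.exp
          simp only [id] at h
          convert h using 2
        simpa using (he.mul_const r).const_add 1
      have h2 := (h1.rpow_const (p := 1 - a) (Or.inl (hw s).ne')).const_mul K
      refine h2.congr_deriv ?_
      rw [show (1 - a - 1) = -a by ring, hK]
      field_simp
      ring
    have hlim : Tendsto (fun t : ℝ => K * (1 + exp (-(t / 2)) * r) ^ (1 - a)) atTop (𝓝 (K * (1 + 0 * r) ^ (1 - a))) := by
      have h1 : Tendsto (fun t : ℝ => exp (-(t / 2))) atTop (𝓝 0) := by
        have : Tendsto (fun t : ℝ => -(t / 2)) atTop atBot := by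
          refine tendsto_atBot_mono (fun t => le_of_eq rfl) ?_
          exact tendsto_neg_atTop_atBot.comp (tendsto_id.atTop_div_const (by norm_num : (0:ℝ) < 2))
        exact tendsto_exp_atBot.comp this
      have h2 : Tendsto (fun t : ℝ => 1 + exp (-(t / 2)) * r) atTop (𝓝 (1 + 0 * r)) :=
        (h1.mul_const r).const_add 1
      exact (h2.rpow_const (Or.inl (by simp))).const_mul K
    rw [zero_mul, add_zero, one_rpow, mul_one] at hlim
    have hcont0 : ContinuousWithinAt (fun t : ℝ => K * (1 + exp (-(t / 2)) * r) ^ (1 - a)) (Ici 0) 0 :=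
      (hderiv 0).continuousAt.continuousWithinAt
    have hFTC := integral_Ioi_of_hasDerivAt_of_tendsto hcont0 (fun s _ => hderiv s) hint hlim
    rw [hFTC]
    simp only [neg_zero, zero_div, exp_zero, one_mul]
    -- `K - K (1+r)^{1-a} ≤ K ≤ (2a/(a-1))/(1+r)`
    have h1 : K - K * (1 + r) ^ (1 - a) ≤ K := by
      have : 0 ≤ K * (1 + r) ^ (1 - a) := by positivity
      linarith
    refine h1.trans ?_
    rw [hK, div_le_div_iff₀ (by positivity) (by positivity)]
    have : 2 * a / (a - 1) * ((a - 1) * r) = 2 * a * r := by field_simp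
    rw [this]
    nlinarith

end Summit.NavierStokesRegularity.NavierStokesRegularity.Theorems.KelvinGate

end
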